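import Summits.KontsevichZagierPeriods.KontsevichZagierPeriods.Theorems.KzOnePeriodsE1DerivCMUnits

/-!
# E1 derivations, part 8: the row engine for coefficients in `ℚ(α)`

Sub-problem `KzOnePeriods` (the theorem of Huber–Wüstholz [cite: HuberWustholz2022, Thm 13.3 (2)
p.121]); helper lane of the `E1` derivation modules, continuing part 7
(`KzOnePeriodsE1DerivCMUnits`); the rows themselves are in part 9 (`KzOnePeriodsE1DerivCMRows`).

For a unit `α` of the period lattice (`αΛ = Λ`) the `kz1p` certificates contain, next to the
symbols `(E, ω, φ∘D_j)` with `D_j : t₀ ↝ t₀ + m_j` (`m_j` = the abelian logarithm of a rational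
point or the real period), symbols at the image points `[α]P` (logarithm `α m_j`) and the image
period `αΩ₁`, in rows `Σ_a c_a (E, ω, φ∘D_a)` with `c_a ∈ ℚ(α)`.  The engine `spanC_unit_rows`
derives such a row, modulo an algebraic multiple of the unit symbol, at EVERY algebraic base point
and for ALL lifts `D_a : t₀ ↝ t₀ + M_a`, `M_a = Σ_j p_aj m_j + Σ_j q_aj (α m_j)` (`p, q` integer
matrices), from

* integer relations `Σ_j n_tj m_j = 0` among the base logarithms (decided by the generator from
  the group law, parts 2–6), and
* the exact identity of coefficient vectors `Σ_a c_a (p_aj + β q_aj) = Σ_t λ_t n_tj` over `ℚ(α)`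
  (`β` the CM multiplier of the form under (R3): `α` for `θ₀`, `α⁻¹` for `θ₁`),

by translation to a generic base point (part 1), additivity (R5)+(R4), the PIN relations (part 7)
and exact linear algebra.  It is written once for a general form `ω` with the three rules as
hypotheses (`htrans`, `hzsum`, `hpin`).
[cite: HuberWustholz2022, §13.1 (A)–(B) p.120, Thm 13.3 (2) p.121, §18.1 pp.160–161]

No new axioms; no statements of the programme are cited.
-/

noncomputable section

open MvPolynomial Set Complex
open Literature.NumberTheory.Transcendental Literature.NumberTheory.Transcendental.CurvePeriods
open Literature.NumberTheory.Transcendental.CurvePeriods.Ell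
open scoped PeriodPair

namespace Summit.KontsevichZagierPeriods.KzOnePeriods.E1LiftDerivation

/-- `c` lies in the `ℚ̄`-span of the elementary relations (R1)–(R5). -/
local notation3 "InSpanRel " c:arg => ∃ (k : ℕ) (ρ : Fin k → (PeriodSymbol →₀ ℂ))
  (a : Fin k → ℂ), (∀ l, IsElementaryRelation (ρ l)) ∧ (∀ l, IsAlgebraic ℚ (a l)) ∧
    c = ∑ l, a l • ρ l

variable {L : PeriodPair} (h₂ : IsAlgebraic ℚ L.g₂) (h₃ : IsAlgebraic ℚ L.g₃)

local notation3 "S₀[" D "]" => LiftData.sym h₂ h₃ D (theta0 L) (hasAlgCoeffs_theta0 L h₂ h₃)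
local notation3 "S₁[" D "]" => LiftData.sym h₂ h₃ D (theta1 L) (hasAlgCoeffs_theta1 L h₂ h₃)
local notation3 (prettyPrint := false) "Sω[" D "]" =>
  LiftData.sym h₂ h₃ D ((1 / 2 : ℂ) • theta0 L) (hasAlgCoeffs_half_theta0 h₂ h₃)
local notation3 (prettyPrint := false) "Sη[" D "]" =>
  LiftData.sym h₂ h₃ D ((1 / 2 : ℂ) • theta1 L) (hasAlgCoeffs_half_theta1 h₂ h₃)
local notation3 "𝟙" => (Finsupp.single PeriodSymbol.unit (1 : ℂ) : PeriodSymbol →₀ ℂ)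

/-- `c` is congruent to an algebraic multiple of the unit symbol modulo (R1)–(R5). -/
local notation3 "InSpanC " c:arg => ∃ κ : ℂ, IsAlgebraic ℚ κ ∧ InSpanRel (c - κ • 𝟙)

/-! ## 1. Congruences modulo algebraic multiples of the unit symbol -/

/-- A span member is congruent to `0` modulo algebraic multiples of `𝟙`. [folklore] -/
theorem spanC_of_span {x : PeriodSymbol →₀ ℂ} (h : InSpanRel x) : InSpanC x :=
  ⟨0, isAlgebraic_zero, by rwa [zero_smul, sub_zero]⟩

/-- Congruence modulo `ℚ̄·𝟙` is additive. [folklore] -/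
theorem spanC_add {x y : PeriodSymbol →₀ ℂ} (hx : InSpanC x) (hy : InSpanC y) :
    InSpanC (x + y) := by
  obtain ⟨κ, hκ, hx⟩ := hx
  obtain ⟨κ', hκ', hy⟩ := hy
  refine ⟨κ + κ', hκ.add hκ', ?_⟩
  have e : x + y - (κ + κ') • 𝟙 = x - κ • 𝟙 + (y - κ' • 𝟙) := by rw [add_smul]; abel
  rw [e]; exact CurvePeriods.span_add hx hy

/-- Congruence modulo `ℚ̄·𝟙` respects subtraction. [folklore] -/
theorem spanC_sub {x y : PeriodSymbol →₀ ℂ} (hx : InSpanC x) (hy : InSpanC y) :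
    InSpanC (x - y) := by
  obtain ⟨κ, hκ, hx⟩ := hx
  obtain ⟨κ', hκ', hy⟩ := hy
  refine ⟨κ - κ', hκ.sub hκ', ?_⟩
  have e : x - y - (κ - κ') • 𝟙 = x - κ • 𝟙 - (y - κ' • 𝟙) := by rw [sub_smul]; abel
  rw [e]; exact CurvePeriods.span_sub hx hy

/-- Congruence modulo `ℚ̄·𝟙` respects algebraic scalars. [folklore] -/
theorem spanC_smul {x : PeriodSymbol →₀ ℂ} {s : ℂ} (hs : IsAlgebraic ℚ s) (hx : InSpanC x) :
    InSpanC (s • x) := by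
  obtain ⟨κ, hκ, hx⟩ := hx
  refine ⟨s * κ, hs.mul hκ, ?_⟩
  have e : s • x - (s * κ) • 𝟙 = s • (x - κ • 𝟙) := by rw [smul_sub, smul_smul]
  rw [e]; exact CurvePeriods.span_smul hs hx

/-- Congruence modulo `ℚ̄·𝟙` respects finite sums. [folklore] -/
theorem spanC_sum {ι : Type*} [Fintype ι] (f : ι → PeriodSymbol →₀ ℂ) (h : ∀ i, InSpanC (f i)) :
    InSpanC (∑ i, f i) := by
  choose κ hκ hs using h
  refine ⟨∑ i, κ i, isAlgebraic_finsetSum _ _ fun i _ => hκ i, ?_⟩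
  have e : ∑ i, f i - (∑ i, κ i) • 𝟙 = ∑ i, (f i - κ i • 𝟙) := by
    rw [Finset.sum_smul, ← Finset.sum_sub_distrib]
  rw [e]; exact CurvePeriods.span_finsetSum _ _ fun i _ => hs i

/-- Assembly by exact linear algebra over `ℚ̄`, modulo constants (cf. `span_of_coef_eq`). -/
theorem spanC_of_coef_eq {n T : ℕ} (S : Fin n → (PeriodSymbol →₀ ℂ)) (α : Fin n → ℂ)
    (K : Fin T → Fin n → ℂ) (hrel : ∀ t, InSpanC (∑ j, K t j • S j))
    (lam : Fin T → ℂ) (hlam : ∀ t, IsAlgebraic ℚ (lam t))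
    (hcoef : ∀ j, α j = ∑ t, lam t * K t j) : InSpanC (∑ j, α j • S j) := by
  have h : InSpanC (∑ t, lam t • ∑ j, K t j • S j) :=
    spanC_sum _ fun t => spanC_smul (hlam t) (hrel t)
  have e : ∑ j, α j • S j = ∑ t, lam t • ∑ j, K t j • S j := by
    simp_rw [Finset.smul_sum, smul_smul]
    rw [Finset.sum_comm]
    exact Finset.sum_congr rfl fun j _ => by rw [← Finset.sum_smul, ← hcoef j]
  rw [e]; exact h

/-! ## 2. Exact linear algebra of the numbers -/

/-- **Row numbers.** If `X_a = Σ_j (p_aj + γ q_aj) x_j`, `Σ_j n_tj x_j + k_t = 0` for all `t` and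
`Σ_a (c_a p_aj + c_a γ q_aj) = Σ_t μ_t n_tj` for all `j`, then `Σ_a c_a X_a + Σ_t μ_t k_t = 0`.
[folklore] -/
theorem unit_rows_numbers {r R T : ℕ} (x : Fin r → ℂ) (X : Fin R → ℂ) (γ : ℂ)
    (p q : Fin R → Fin r → ℤ) (hX : ∀ a, X a = ∑ j, ((p a j : ℂ) * x j + (q a j : ℂ) * (γ * x j)))
    (c cγ : Fin R → ℂ) (hcγ : ∀ a, cγ a = c a * γ) (n : Fin T → Fin r → ℤ) (kt : Fin T → ℂ)
    (hrows : ∀ t, ∑ j, (n t j : ℂ) * x j + kt t = 0) (μ : Fin T → ℂ)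
    (hcoef : ∀ j, ∑ a, (c a * (p a j : ℂ) + cγ a * (q a j : ℂ)) = ∑ t, μ t * (n t j : ℂ))
    {k : ℂ} (hk : ∑ t, μ t * kt t = k) : ∑ a, c a * X a + k = 0 := by
  have h1 : ∑ a, c a * X a = ∑ j, (∑ t, μ t * (n t j : ℂ)) * x j := by
    simp only [hX, Finset.mul_sum]
    rw [Finset.sum_comm]
    refine Finset.sum_congr rfl fun j _ => ?_
    rw [← hcoef j, Finset.sum_mul]
    exact Finset.sum_congr rfl fun a _ => by rw [hcγ a]; ring
  have h2 : ∑ j, (∑ t, μ t * (n t j : ℂ)) * x j = ∑ t, μ t * ∑ j, (n t j : ℂ) * x j := by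
    simp only [Finset.sum_mul, Finset.mul_sum]
    rw [Finset.sum_comm]
    exact Finset.sum_congr rfl fun t _ => Finset.sum_congr rfl fun j _ => by ring
  rw [h1, h2, ← hk, ← Finset.sum_add_distrib]
  exact Finset.sum_eq_zero fun t _ => by rw [← mul_add, hrows t, mul_zero]

/-! ## 3. The row engine (general form, modulo constants) -/

section Engine

variable (ω : Fin 2 → MvPolynomial (Fin 2) ℂ) (hω : ∀ k, HasAlgCoeffs (ω k))

/-- The symbol `(E_L, ω, φ∘D)` of a lift for the form `ω` of this section. -/
local notation3 "Sy[" D "]" => LiftData.sym h₂ h₃ D ω hω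

/-- Fintype-indexed version of an integer-relation rule (`span_zsum_theta0/theta1`). -/
theorem spanC_zsum_fintype
    (hzsum : ∀ {k : ℕ} (m : Fin k → ℂ), (∀ l, AlgLog L (m l)) → ∀ (n : Fin k → ℤ),
      ∑ l, (n l : ℂ) * m l = 0 → ∀ {t₀ : ℂ}, IsAlgPt L t₀ →
      ∀ (D : ∀ l, LiftData L t₀ (t₀ + m l)), InSpanC (∑ l, (n l : ℂ) • Sy[D l]))
    {ι : Type*} [Fintype ι] (m : ι → ℂ) (hm : ∀ i, AlgLog L (m i)) (n : ι → ℤ)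
    (hsum : ∑ i, (n i : ℂ) * m i = 0) {t₀ : ℂ} (ht₀ : IsAlgPt L t₀)
    (D : ∀ i, LiftData L t₀ (t₀ + m i)) : InSpanC (∑ i, (n i : ℂ) • Sy[D i]) := by
  classical
  let e := Fintype.equivFin ι
  have h := hzsum (fun l => m (e.symm l)) (fun l => hm _) (fun l => n (e.symm l))
    (by rwa [e.symm.sum_comp (fun i => (n i : ℂ) * m i)]) ht₀ (fun l => D (e.symm l))
  rwa [e.symm.sum_comp (fun i => (n i : ℂ) • Sy[D i])] at h

/-- **Additivity** for a logarithm `M = Σ_j p_j m_j + Σ_j q_j m′_j`: the symbol of any lift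
`D₁ : t₁ ↝ t₁ + M` against the base lifts `B_j : t₁ ↝ t₁ + m_j`, `B′_j : t₁ ↝ t₁ + m′_j`.
[cite: HuberWustholz2022, §13.1 (B) p.120; §18.1 pp.160–161] -/
theorem spanC_lincomb
    (hzsum : ∀ {k : ℕ} (m : Fin k → ℂ), (∀ l, AlgLog L (m l)) → ∀ (n : Fin k → ℤ),
      ∑ l, (n l : ℂ) * m l = 0 → ∀ {t₀ : ℂ}, IsAlgPt L t₀ →
      ∀ (D : ∀ l, LiftData L t₀ (t₀ + m l)), InSpanC (∑ l, (n l : ℂ) • Sy[D l]))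
    {r r' : ℕ} (m : Fin r → ℂ) (m' : Fin r' → ℂ) (hm : ∀ j, AlgLog L (m j))
    (hm' : ∀ j, AlgLog L (m' j)) {M : ℂ} (hMa : AlgLog L M) (p : Fin r → ℤ) (q : Fin r' → ℤ)
    (hM : M = ∑ j, (p j : ℂ) * m j + ∑ j, (q j : ℂ) * m' j) {t₁ : ℂ} (ht₁ : IsAlgPt L t₁)
    (B : ∀ j, LiftData L t₁ (t₁ + m j)) (B' : ∀ j, LiftData L t₁ (t₁ + m' j))
    (D₁ : LiftData L t₁ (t₁ + M)) :
    InSpanC (Sy[D₁] - ∑ j, (p j : ℂ) • Sy[B j] - ∑ j, (q j : ℂ) • Sy[B' j]) := by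
  obtain ⟨κ, hκ, h⟩ := spanC_zsum_fintype h₂ h₃ ω hω hzsum (ι := Option (Fin r ⊕ Fin r'))
    (fun o => o.elim M (Sum.elim m m'))
    (by rintro (_ | j | j); exacts [hMa, hm j, hm' j])
    (fun o => o.elim 1 (Sum.elim (fun j => -p j) (fun j => -q j)))
    (by
      rw [Fintype.sum_option, Fintype.sum_sum_type]
      simp only [Option.elim_none, Option.elim_some, Sum.elim_inl, Sum.elim_inr, Int.cast_one,
        one_mul, Int.cast_neg, neg_mul, Finset.sum_neg_distrib, hM]
      ring)
    ht₁ (fun o => match o with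
      | none => D₁
      | some (Sum.inl j) => B j
      | some (Sum.inr j) => B' j)
  refine ⟨κ, hκ, ?_⟩
  rw [Fintype.sum_option, Fintype.sum_sum_type] at h
  have e : Sy[D₁] - ∑ j, (p j : ℂ) • Sy[B j] - ∑ j, (q j : ℂ) • Sy[B' j] =
      ((1 : ℤ) : ℂ) • Sy[D₁] +
        (∑ j, ((-p j : ℤ) : ℂ) • Sy[B j] + ∑ j, ((-q j : ℤ) : ℂ) • Sy[B' j]) := by
    simp only [Int.cast_one, one_smul, Int.cast_neg, neg_smul, Finset.sum_neg_distrib]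
    abel
  rw [e]
  exact h

/-- **The row engine.** See the file header. `htrans`, `hzsum`, `hpin` are the translation,
integer-relation and PIN rules for the form `ω` with CM multiplier `β`. -/
theorem spanC_unit_rows
    (htrans : ∀ {a b v : ℂ}, IsAlgPt L v → ∀ (D : LiftData L a b) (D' : LiftData L (a + v) (b + v)),
      ℘[L] a ≠ ℘[L] v → ℘[L] b ≠ ℘[L] v → InSpanC (Sy[D'] - Sy[D]))
    (hzsum : ∀ {k : ℕ} (m : Fin k → ℂ), (∀ l, AlgLog L (m l)) → ∀ (n : Fin k → ℤ),
      ∑ l, (n l : ℂ) * m l = 0 → ∀ {t₀ : ℂ}, IsAlgPt L t₀ →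
      ∀ (D : ∀ l, LiftData L t₀ (t₀ + m l)), InSpanC (∑ l, (n l : ℂ) • Sy[D l]))
    {α β : ℂ} (hα : α ≠ 0) (hU : ∀ x, α * x ∈ L.lattice ↔ x ∈ L.lattice)
    (hpin : ∀ {m t₀ : ℂ}, AlgLog L m → IsAlgPt L t₀ → ∀ (D : LiftData L t₀ (t₀ + m))
      (D' : LiftData L t₀ (t₀ + α * m)), InSpanC (Sy[D'] - β • Sy[D]))
    {r : ℕ} (m : Fin r → ℂ) (hm : ∀ j, AlgLog L (m j))
    {R : ℕ} (M : Fin R → ℂ) (p q : Fin R → Fin r → ℤ)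
    (hM : ∀ a, M a = ∑ j, ((p a j : ℂ) * m j + (q a j : ℂ) * (α * m j)))
    (c cβ : Fin R → ℂ) (hc : ∀ a, IsAlgebraic ℚ (c a)) (hcβ : ∀ a, cβ a = c a * β)
    {T : ℕ} (n : Fin T → Fin r → ℤ) (hn : ∀ t, ∑ j, (n t j : ℂ) * m j = 0)
    (lam : Fin T → ℂ) (hlam : ∀ t, IsAlgebraic ℚ (lam t))
    (hcoef : ∀ j, ∑ a, (c a * (p a j : ℂ) + cβ a * (q a j : ℂ)) = ∑ t, lam t * (n t j : ℂ))
    {t₀ : ℂ} (ht₀ : IsAlgPt L t₀) (D : ∀ a, LiftData L t₀ (t₀ + M a)) :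
    InSpanC (∑ a, c a • Sy[D a]) := by
  classical
  have hαm : ∀ j, AlgLog L (α * m j) := fun j => algLog_unit_mul h₂ h₃ hα hU (hm j)
  have hMalg : ∀ a, AlgLog L (M a) := fun a => by
    rw [hM a]
    exact AlgLog.sum L h₂ _ _ fun j _ =>
      ((hm j).zsmul L h₂ (p a j)).add L h₂ ((hαm j).zsmul L h₂ (q a j))
  have htM : ∀ a, t₀ + M a ∉ L.lattice := fun a => (D a).alg_stop.1
  -- a generic base point `t₁`
  obtain ⟨t₁, ht₁, hB, hC⟩ := exists_generic_algPt₂ h₂ h₃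
    (insert t₀ (((Finset.univ.image fun j => -m j) ∪ Finset.univ.image fun j => -(α * m j)) ∪
      Finset.univ.image fun a => -M a))
    (insert t₀ (Finset.univ.image fun a => t₀ - M a))
  have hB1 : ∀ j, t₁ + m j ∉ L.lattice := fun j => by
    simpa [sub_neg_eq_add] using hB (-m j) (Finset.mem_insert_of_mem (Finset.mem_union_left _
      (Finset.mem_union_left _ (Finset.mem_image_of_mem _ (Finset.mem_univ j)))))
  have hB2 : ∀ j, t₁ + α * m j ∉ L.lattice := fun j => by
    simpa [sub_neg_eq_add] using hB (-(α * m j)) (Finset.mem_insert_of_mem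
      (Finset.mem_union_left _ (Finset.mem_union_right _
        (Finset.mem_image_of_mem _ (Finset.mem_univ j)))))
  have hB3 : ∀ a, t₁ + M a ∉ L.lattice := fun a => by
    simpa [sub_neg_eq_add] using hB (-M a) (Finset.mem_insert_of_mem
      (Finset.mem_union_right _ (Finset.mem_image_of_mem _ (Finset.mem_univ a))))
  have Bj : ∀ j, LiftData L t₁ (t₁ + m j) := fun j =>
    (LiftData.nonempty ht₁ ((ht₁.algLog.add L h₂ (hm j)).isAlgPt (hB1 j))).some
  have Bj' : ∀ j, LiftData L t₁ (t₁ + α * m j) := fun j =>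
    (LiftData.nonempty ht₁ ((ht₁.algLog.add L h₂ (hαm j)).isAlgPt (hB2 j))).some
  have D₁ : ∀ a, LiftData L t₁ (t₁ + M a) := fun a =>
    (LiftData.nonempty ht₁ ((ht₁.algLog.add L h₂ (hMalg a)).isAlgPt (hB3 a))).some
  -- (1) translation from base `t₁` to base `t₀`
  set v := t₀ - t₁ with hv
  have hv0 : v ∉ L.lattice := fun h =>
    hB t₀ (Finset.mem_insert_self _ _) (by simpa [hv] using neg_mem h)
  have hvalg : IsAlgPt L v := (ht₀.algLog.sub L h₂ ht₁.algLog).isAlgPt hv0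
  have htr : ∀ a, InSpanC (Sy[D a] - Sy[D₁ a]) := fun a => by
    have e0 : t₁ + v = t₀ := by rw [hv]; ring
    have e1 : t₁ + M a + v = t₀ + M a := by rw [hv]; ring
    have ha : ℘[L] t₁ ≠ ℘[L] v := by
      rw [weierstrassP_ne_iff L ht₁.1 hv0]
      refine ⟨by rw [e0]; exact ht₀.1, ?_⟩
      have : 2 * t₁ - t₀ ∉ L.lattice := hC t₀ (Finset.mem_insert_self _ _)
      convert this using 2; rw [hv]; ring
    have hb : ℘[L] (t₁ + M a) ≠ ℘[L] v := by
      rw [weierstrassP_ne_iff L (hB3 a) hv0]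
      refine ⟨by rw [e1]; exact htM a, ?_⟩
      have : 2 * t₁ - (t₀ - M a) ∉ L.lattice := hC (t₀ - M a)
        (Finset.mem_insert_of_mem (Finset.mem_image_of_mem _ (Finset.mem_univ a)))
      convert this using 2; rw [hv]; ring
    have key := htrans hvalg (D₁ a) ((D a).cast e0.symm e1.symm) ha hb
    rwa [LiftData.sym_cast] at key
  -- (2) additivity at `t₁`
  have hadd : ∀ a, InSpanC (Sy[D₁ a] - ∑ j, (p a j : ℂ) • Sy[Bj j] -
      ∑ j, (q a j : ℂ) • Sy[Bj' j]) := fun a =>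
    spanC_lincomb h₂ h₃ ω hω hzsum m (fun j => α * m j) hm hαm (hMalg a) (p a) (q a)
      (by rw [hM a, Finset.sum_add_distrib]) ht₁ Bj Bj' (D₁ a)
  -- (3) the PIN relations and (4) the integer relations among the base lifts at `t₁`
  have hpin' : ∀ j, InSpanC (Sy[Bj' j] - β • Sy[Bj j]) := fun j => hpin (hm j) ht₁ (Bj j) (Bj' j)
  have hzs : ∀ t, InSpanC (∑ j, (n t j : ℂ) • Sy[Bj j]) := fun t =>
    hzsum m hm (n t) (hn t) ht₁ Bj
  -- reduced coefficients
  have hPQ : ∀ j, (∑ a, c a * (p a j : ℂ)) + (∑ a, c a * (q a j : ℂ)) * β =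
      ∑ t, lam t * (n t j : ℂ) := fun j => by
    rw [← hcoef j, Finset.sum_mul, ← Finset.sum_add_distrib]
    exact Finset.sum_congr rfl fun a _ => by rw [hcβ a]; ring
  have hQalg : ∀ j, IsAlgebraic ℚ (∑ a, c a * (q a j : ℂ)) := fun j =>
    isAlgebraic_finsetSum _ _ fun a _ => (hc a).mul (isAlgebraic_int _)
  -- the four pieces
  have hS1 : InSpanC (∑ a, c a • (Sy[D a] - Sy[D₁ a])) :=
    spanC_sum _ fun a => spanC_smul (hc a) (htr a)
  have hS2 : InSpanC (∑ a, c a • (Sy[D₁ a] - ∑ j, (p a j : ℂ) • Sy[Bj j] -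
      ∑ j, (q a j : ℂ) • Sy[Bj' j])) :=
    spanC_sum _ fun a => spanC_smul (hc a) (hadd a)
  have hS3 : InSpanC (∑ j, (∑ a, c a * (q a j : ℂ)) • (Sy[Bj' j] - β • Sy[Bj j])) :=
    spanC_sum _ fun j => spanC_smul (hQalg j) (hpin' j)
  have hS4 : InSpanC (∑ j, ((∑ a, c a * (p a j : ℂ)) + (∑ a, c a * (q a j : ℂ)) * β) • Sy[Bj j]) :=
    spanC_of_coef_eq _ _ (fun t j => (n t j : ℂ)) hzs lam hlam fun j => hPQ j
  -- regrouping of the double sums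
  have eP : ∑ a, c a • ∑ j, (p a j : ℂ) • Sy[Bj j] = ∑ j, (∑ a, c a * (p a j : ℂ)) • Sy[Bj j] := by
    simp only [Finset.smul_sum, smul_smul, Finset.sum_smul]
    exact Finset.sum_comm
  have eQ : ∑ a, c a • ∑ j, (q a j : ℂ) • Sy[Bj' j] =
      ∑ j, (∑ a, c a * (q a j : ℂ)) • Sy[Bj' j] := by
    simp only [Finset.smul_sum, smul_smul, Finset.sum_smul]
    exact Finset.sum_comm
  have e : ∑ a, c a • Sy[D a] = ∑ a, c a • (Sy[D a] - Sy[D₁ a]) +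
      ∑ a, c a • (Sy[D₁ a] - ∑ j, (p a j : ℂ) • Sy[Bj j] - ∑ j, (q a j : ℂ) • Sy[Bj' j]) +
      ∑ j, (∑ a, c a * (q a j : ℂ)) • (Sy[Bj' j] - β • Sy[Bj j]) +
      ∑ j, ((∑ a, c a * (p a j : ℂ)) + (∑ a, c a * (q a j : ℂ)) * β) • Sy[Bj j] := by
    simp only [smul_sub, Finset.sum_sub_distrib, eP, eQ, add_smul, Finset.sum_add_distrib,
      smul_smul]
    abel
  rw [e]
  exact spanC_add (spanC_add (spanC_add hS1 hS2) hS3) hS4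

end Engine

end Summit.KontsevichZagierPeriods.KzOnePeriods.E1LiftDerivation

end
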